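import Literature.Analysis.FluidPDE.RestrictedEulerDynamics
import HarnessLib

/-!
# The half-turn rung-2 centre germ: triaxiality letter ⇔ `0 < |π₀|² ≠ 9 m₀²` (Negative lane, supports BC5 rung 2)

Definitive form of `AxisymmetricGermNotTriaxial` / `StrainSectorGermDiscriminant` (same folder).  In the half-turn
cell `C_2h` at rung `2` a profile has centre velocity gradient (PREREG-Z2-HT v1.1 §1; circuit AGL-RUNG2-STRUCTURE §0)

  `∇U(0) = 3𝒜(0) + B(0)[e₃]ₓ = G(m, p, q, b) := !![3(m+p), 3q − b, 0; 3q + b, 3(m−p), 0; 0, 0, −6m]`,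

`𝒜(0) = [[m+p, q, 0], [q, m−p, 0], [0, 0, −2m]]` the strain block (`π₀ = p + iq` the doublet, `m` the axisymmetric part),
`b = B(0)` the swirl.  We compute, in closed form,

* the strain germ `½(G + Gᵀ) − (tr G/3)·1 = S(m, p, q) := !![3(m+p), 3q, 0; 3q, 3(m−p), 0; 0, 0, −6m]` (the swirl drops out);
* its restricted-Euler discriminant `D(S) = Q³ + (27/4)R² = −729 · (p² + q²) · (9m² − p² − q²)²`;
* `tr(GᵀG) = 54m² + 18p² + 18q² + 2b²`;

and conclude that the half-turn rung's triaxiality letter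
`IsTriaxial η G := 0 < tr(GᵀG) ∧ D(strain germ of G) ≤ −η·(tr GᵀG)³` (`Cruxes/RungBlowupCofinal/Lines/halfturn.lean` v4)
holds for SOME floor `η > 0` **iff `0 < p² + q²` and `p² + q² ≠ 9m²`** — i.e. `|π₀| ∉ {0, 3|m₀|}`, the printed
centre-germ letter — with the explicit floor `η = 729(p²+q²)(9m²−p²−q²)²/(tr GᵀG)³` on the good side, and fails for EVERY
`η > 0` on the two degenerate loci (axis-type germ `π₀ = 0`, which contains the whole «axi» census sector and the m = 0
strata; and the coincidence cone `|π₀| = 3|m₀|`).  All statements carry `hG : G = G(m,p,q,b)`, so each is definitionally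
the corresponding statement about `IsTriaxial η G` (the Lines file is not importable here).

Nothing in this file asserts a Theses declaration.
-/

namespace Summit.NavierStokesRegularity.RungBlowupCofinalHalfTurnGerm

open Matrix Literature.Analysis.FluidPDE

/-- The half-turn germ is trace-free (incompressibility at the centre). -/
theorem trace_halfTurnGerm (m p q b : ℝ) {G : Matrix (Fin 3) (Fin 3) ℝ}
    (hG : G = !![3 * (m + p), 3 * q - b, 0; 3 * q + b, 3 * (m - p), 0; 0, 0, -6 * m]) : G.trace = 0 := by
  subst hG
  rw [Matrix.trace_fin_three]
  simp
  ring

/-- **Strain germ of the half-turn centre gradient**: the swirl `b` drops out. -/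
theorem strainGerm_halfTurn (m p q b : ℝ) {G : Matrix (Fin 3) (Fin 3) ℝ}
    (hG : G = !![3 * (m + p), 3 * q - b, 0; 3 * q + b, 3 * (m - p), 0; 0, 0, -6 * m]) :
    (1 / 2 : ℝ) • (G + Gᵀ) - (G.trace / 3) • (1 : Matrix (Fin 3) (Fin 3) ℝ) =
      !![3 * (m + p), 3 * q, 0; 3 * q, 3 * (m - p), 0; 0, 0, -6 * m] := by
  rw [trace_halfTurnGerm m p q b hG, zero_div, zero_smul, sub_zero]
  subst hG
  ext i j
  simp only [Matrix.smul_apply, Matrix.add_apply, Matrix.transpose_apply, smul_eq_mul]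
  fin_cases i <;> fin_cases j <;> simp only [Fin.isValue, Fin.zero_eta, Fin.mk_one, Fin.reduceFinMk] <;> simp <;> ring

/-- **Closed form of the discriminant of the strain germ**: `D = −729 (p² + q²) (9m² − p² − q²)²`
(`= −¼∏(λᵢ − λⱼ)²` for the strain eigenvalues `3(m ± |π₀|), −6m`). -/
theorem discr_strainGerm_halfTurn (m p q b : ℝ) {G : Matrix (Fin 3) (Fin 3) ℝ}
    (hG : G = !![3 * (m + p), 3 * q - b, 0; 3 * q + b, 3 * (m - p), 0; 0, 0, -6 * m]) :
    VelocityGradient.discr ((1 / 2 : ℝ) • (G + Gᵀ) - (G.trace / 3) • (1 : Matrix (Fin 3) (Fin 3) ℝ)) =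
      -729 * (p ^ 2 + q ^ 2) * (9 * m ^ 2 - p ^ 2 - q ^ 2) ^ 2 := by
  rw [strainGerm_halfTurn m p q b hG, VelocityGradient.discr_def, VelocityGradient.invQ_def,
    VelocityGradient.invR_def]
  simp only [Matrix.trace_fin_three, Matrix.mul_apply, Fin.sum_univ_three]
  simp
  ring

/-- `tr(GᵀG) = 54m² + 18p² + 18q² + 2b²` (Frobenius norm squared of the germ). -/
theorem trace_transpose_mul_halfTurnGerm (m p q b : ℝ) {G : Matrix (Fin 3) (Fin 3) ℝ}
    (hG : G = !![3 * (m + p), 3 * q - b, 0; 3 * q + b, 3 * (m - p), 0; 0, 0, -6 * m]) :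
    (Gᵀ * G).trace = 54 * m ^ 2 + 18 * p ^ 2 + 18 * q ^ 2 + 2 * b ^ 2 := by
  subst hG
  rw [Matrix.trace_fin_three]
  simp [Matrix.mul_apply, Fin.sum_univ_three]
  ring

/-- **Degenerate doublets never instance the letter.**  If `π₀ = 0` (axis-type germ: the «axi» sector, the
m = 0 strata) or `|π₀|² = 9m₀²` (two coincident strain eigenvalues), the triaxiality letter fails for every floor
`η > 0` — definitionally `¬ IsTriaxial η G`. -/
theorem not_triaxialLetter_halfTurnGerm_degenerate {η : ℝ} (hη : 0 < η) {m p q : ℝ} (b : ℝ)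
    (hdeg : p ^ 2 + q ^ 2 = 0 ∨ p ^ 2 + q ^ 2 = 9 * m ^ 2) {G : Matrix (Fin 3) (Fin 3) ℝ}
    (hG : G = !![3 * (m + p), 3 * q - b, 0; 3 * q + b, 3 * (m - p), 0; 0, 0, -6 * m]) :
    ¬ (0 < (Gᵀ * G).trace ∧
        VelocityGradient.discr ((1 / 2 : ℝ) • (G + Gᵀ) - (G.trace / 3) • (1 : Matrix (Fin 3) (Fin 3) ℝ)) ≤
          -η * ((Gᵀ * G).trace) ^ 3) := by
  rintro ⟨hpos, hle⟩
  rw [discr_strainGerm_halfTurn m p q b hG] at hle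
  have h3 : 0 < ((Gᵀ * G).trace) ^ 3 := pow_pos hpos 3
  have hD : -729 * (p ^ 2 + q ^ 2) * (9 * m ^ 2 - p ^ 2 - q ^ 2) ^ 2 = 0 := by
    rcases hdeg with h | h
    · rw [h]
      ring
    · have : 9 * m ^ 2 - p ^ 2 - q ^ 2 = 0 := by linarith
      rw [this]
      ring
  rw [hD] at hle
  nlinarith

/-- **Non-degenerate doublets DO instance the letter, with an explicit floor.**  If `0 < |π₀|²` and
`|π₀|² ≠ 9m₀²` the letter holds with `η = 729(p²+q²)(9m²−p²−q²)²/(tr GᵀG)³ > 0` — definitionally `IsTriaxial η G`. -/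
theorem triaxialLetter_halfTurnGerm {m p q : ℝ} (b : ℝ) (hpos : 0 < p ^ 2 + q ^ 2) (hne : p ^ 2 + q ^ 2 ≠ 9 * m ^ 2)
    {G : Matrix (Fin 3) (Fin 3) ℝ}
    (hG : G = !![3 * (m + p), 3 * q - b, 0; 3 * q + b, 3 * (m - p), 0; 0, 0, -6 * m]) :
    ∃ η : ℝ, 0 < η ∧ (0 < (Gᵀ * G).trace ∧
        VelocityGradient.discr ((1 / 2 : ℝ) • (G + Gᵀ) - (G.trace / 3) • (1 : Matrix (Fin 3) (Fin 3) ℝ)) ≤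
          -η * ((Gᵀ * G).trace) ^ 3) := by
  have htr : 0 < (Gᵀ * G).trace := by
    rw [trace_transpose_mul_halfTurnGerm m p q b hG]
    nlinarith [sq_nonneg m, sq_nonneg b]
  have hsq : 0 < (9 * m ^ 2 - p ^ 2 - q ^ 2) ^ 2 := by
    have : 9 * m ^ 2 - p ^ 2 - q ^ 2 ≠ 0 := fun h => hne (by linarith)
    positivity
  have hnum : 0 < 729 * (p ^ 2 + q ^ 2) * (9 * m ^ 2 - p ^ 2 - q ^ 2) ^ 2 := by positivity
  have h3 : 0 < ((Gᵀ * G).trace) ^ 3 := pow_pos htr 3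
  refine ⟨729 * (p ^ 2 + q ^ 2) * (9 * m ^ 2 - p ^ 2 - q ^ 2) ^ 2 / ((Gᵀ * G).trace) ^ 3, by positivity, htr, ?_⟩
  rw [discr_strainGerm_halfTurn m p q b hG]
  have hc : 729 * (p ^ 2 + q ^ 2) * (9 * m ^ 2 - p ^ 2 - q ^ 2) ^ 2 / ((Gᵀ * G).trace) ^ 3 * ((Gᵀ * G).trace) ^ 3 =
      729 * (p ^ 2 + q ^ 2) * (9 * m ^ 2 - p ^ 2 - q ^ 2) ^ 2 := div_mul_cancel₀ _ h3.ne'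
  linarith [hc]

/-- **The iff.**  The triaxiality letter holds for some floor iff `0 < |π₀|²` and `|π₀|² ≠ 9m₀²` — the printed
centre-germ letter «triaxial iff `|π₀| ∉ {0, 3|m₀|}`», independent of the swirl `b`. -/
theorem exists_triaxialLetter_halfTurnGerm_iff (m p q b : ℝ) {G : Matrix (Fin 3) (Fin 3) ℝ}
    (hG : G = !![3 * (m + p), 3 * q - b, 0; 3 * q + b, 3 * (m - p), 0; 0, 0, -6 * m]) :
    (∃ η : ℝ, 0 < η ∧ (0 < (Gᵀ * G).trace ∧
        VelocityGradient.discr ((1 / 2 : ℝ) • (G + Gᵀ) - (G.trace / 3) • (1 : Matrix (Fin 3) (Fin 3) ℝ)) ≤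
          -η * ((Gᵀ * G).trace) ^ 3)) ↔
      (0 < p ^ 2 + q ^ 2 ∧ p ^ 2 + q ^ 2 ≠ 9 * m ^ 2) := by
  constructor
  · rintro ⟨η, hη, h⟩
    by_contra hc
    have hdeg : p ^ 2 + q ^ 2 = 0 ∨ p ^ 2 + q ^ 2 = 9 * m ^ 2 := by
      by_cases h0 : p ^ 2 + q ^ 2 = 0
      · exact Or.inl h0
      · right
        by_contra h9
        exact hc ⟨lt_of_le_of_ne (by positivity) (Ne.symm h0), h9⟩
    exact not_triaxialLetter_halfTurnGerm_degenerate hη b hdeg hG h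
  · rintro ⟨hpos, hne⟩
    exact triaxialLetter_halfTurnGerm b hpos hne hG

end Summit.NavierStokesRegularity.RungBlowupCofinalHalfTurnGerm
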